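import Mathlib
import Summits.MatrixMultiplication.MatrixMultiplication.Theses.FourierTwoFamiliesModP
import Summits.MatrixMultiplication.MatrixMultiplication.Theorems.PrimeTwoFamilies.Negative.Slices
import Summits.MatrixMultiplication.MatrixMultiplication.Theorems.FourierTwoFamiliesModPCyclicReductionTransfer
import Summits.MatrixMultiplication.MatrixMultiplication.Theorems.FourierTwoFamiliesModPPrimeTwoFamiliesCapacityLift

/-!
# Capacity gadgets at ONE scale give a slice of `PrimeTwoFamilies`
# (crux stmt-MatrixMultiplication-14308, line `Sketch`, capacity form; stub `primeTwoFamiliesAt_of_capacityGadgets`)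

The capacity-gadget form of the crux `FourierTwoFamiliesModP.PrimeTwoFamilies` (CKSU 2005 Conj. 4.7 with
prime cyclic hosts) says: for every `ε > 0` and arbitrarily large `m` there are direct pairs
`(P c, Q c)_{c<r}` in `ZMod m` of co-volume `|P c||Q c| ≥ m^{1-ε}` and a zero-error code `W` of words
`Fin L → Fin r` (`L ≥ 1`, every ordered pair of distinct words strongly separated in some coordinate) of
size `|W| ≥ (m^L)^{1/2-ε}`.  The tree already knows that gadgets AT EVERY SCALE `ε > 0` give every slice
`PrimeTwoFamiliesAt δ` (`CapacityLift.primeTwoFamiliesAt_of_capacityGadgets`, `CapacityLift.stub_capacityTransfer`,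
both with the fixed bookkeeping scale `ε = δ/16`).

This file makes the SCALE EXPLICIT, which is what a constructor of gadgets needs to know:

* `capacityScale_bookkeeping` — the real-exponent bookkeeping of the transfer at ONE scale, uniform in the
  word length `L ≥ 1`, for every `0 < ε < δ/(4+2δ)`: the thresholds are obtained from Mathlib's asymptotics API
  (`tendsto_rpow_atTop`, `Filter.Tendsto.eventually_ge_atTop`, `Filter.eventually_atTop`) instead of
  explicit ceilings.
* `primeTwoFamiliesAt_of_capacityGadgetsAt` — **single-scale transfer**: capacity gadgets at ANY ONE defect
  `ε < δ/(4+2δ) = 1/2 - 1/(2+δ)` (for arbitrarily large `m`) already give the slice `PrimeTwoFamiliesAt δ`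
  (every `δ > 0`; slices `δ > 2` are trivial by `primeTwoFamiliesAt_two`).  The threshold is the natural one
  for this transfer: the host has size `≈ m^L =: M`, one keeps `n ≈ M^{1/(2+δ)}` of the `M^{1/2-ε}` blocks, so
  `1/(2+δ) < 1/2 - ε` is exactly what is needed.  Equivalently: gadgets at defect `ε < 1/2` give every slice
  `δ > 4ε/(1-2ε)`.
* `primeTwoFamiliesAt_of_capacityGadgets` — the registered stub of the line skeleton
  (`Cruxes/PrimeTwoFamilies/Lines/Sketch.lean`, sha bbad66309330) verbatim, as the corollary `ε := δ/8`.

Composition of the transfer (as in the line): code lift `CapacityLift.codeLift` to `|W|` SDPP blocks in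
`Fin L → ZMod m`, carry-free transfer `Theorems.exists_prime_sdpp_of_addEquiv` into a Bertrand prime
`p ≤ 2·3^L·m^L` with block sizes kept, keep the first `n` blocks.

Helper file of siege attempt k13 (variation: Mathlib API route), landed `--supports stmt-MatrixMultiplication-14308`;
no new definitions.
-/

-- single-conjunct summit: the mandated namespace repeats `MatrixMultiplication` (summit = sub-problem).
set_option linter.dupNamespace false

namespace Summit.MatrixMultiplication.MatrixMultiplication.Theorems.PrimeTwoFamilies.CapacityScale

open Finset Filter
open Summit.MatrixMultiplication.MatrixMultiplication.Theses
open Summit.MatrixMultiplication.MatrixMultiplication.Theorems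
open Summit.MatrixMultiplication.MatrixMultiplication.Theorems.PrimeTwoFamilies.Negative

/-! ## Bookkeeping at one scale (uniform in the word length) -/

/-- **Bookkeeping at one scale, uniform in `L`.**  Let `0 < δ ≤ 2` and `0 < ε < δ/(4+2δ)`.  For every
`n₀` there is a threshold `m₀` (depending on `δ, ε, n₀` only) such that for every level `m ≥ m₀`, every
word length `L ≥ 1`, every code size `N ≥ (m^L)^{1/2-ε}` and every host size `p ≤ 2·3^L·m^L` there is a
number `n` of blocks with `n₀ ≤ n ≤ N`, `p ≤ n^{2+δ}` and `n^{2-δ} ≤ (m^{1-ε})^L`.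
Choice: `n := max n₀ ⌈p^{1/(2+δ)}⌉₊`.  With `M := m^L ≥ m` and the auxiliary exponent
`η := ((1/2-ε)(2+δ) - 1)/2 > 0` one has `2·3^L ≤ 6^L ≤ M^η` once `6 ≤ m^η`, so `p ≤ M^{1+η}` and
`n ≤ 2 M^{(1+η)/(2+δ)} ≤ M^{1/2-ε}` once `2 ≤ m^g`, `g := 1/2 - ε - (1+η)/(2+δ) > 0`; finally
`n^{2-δ} ≤ M^{(1/2-ε)(2-δ)} ≤ M^{1-ε}`.  The three thresholds (`n₀ ≤ m^{1/2-ε}`, `6 ≤ m^η`, `2 ≤ m^g`)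
come from `tendsto_rpow_atTop`. -/
theorem capacityScale_bookkeeping {δ ε : ℝ} (hδ : 0 < δ) (hδ2 : δ ≤ 2) (hε : 0 < ε)
    (hεδ : ε < δ / (4 + 2 * δ)) (n₀ : ℕ) :
    ∃ m₀ : ℕ, ∀ m : ℕ, m₀ ≤ m → ∀ L : ℕ, 1 ≤ L →
      ∀ N : ℕ, ((m : ℝ) ^ (L : ℝ)) ^ (1 / 2 - ε) ≤ (N : ℝ) →
      ∀ p : ℕ, p ≤ 2 * (3 ^ L * m ^ L) →
        ∃ n : ℕ, n₀ ≤ n ∧ n ≤ N ∧ (p : ℝ) ≤ (n : ℝ) ^ (2 + δ) ∧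
          (n : ℝ) ^ (2 - δ) ≤ ((m : ℝ) ^ (1 - ε)) ^ L := by
  have h2δ : (0 : ℝ) < 2 + δ := by linarith
  have h42δ : (0 : ℝ) < 4 + 2 * δ := by linarith
  have hεδ' : ε * (4 + 2 * δ) < δ := (lt_div_iff₀ h42δ).1 hεδ
  have hεδ0 : 0 ≤ ε * δ := mul_nonneg hε.le hδ.le
  have hε2 : 0 < 1 / 2 - ε := by nlinarith
  -- the auxiliary exponent `η` (host overhead `2·3^L ≤ M^η`) and the final gap `g`
  set η : ℝ := ((1 / 2 - ε) * (2 + δ) - 1) / 2 with hη_def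
  have hη : 0 < η := by
    rw [hη_def]
    nlinarith
  set g : ℝ := 1 / 2 - ε - (1 + η) / (2 + δ) with hg_def
  have hg : 0 < g := by
    rw [hg_def, sub_pos, div_lt_iff₀ h2δ]
    linarith
  have hexp : (1 / 2 - ε) * (2 - δ) ≤ 1 - ε := by
    nlinarith [mul_nonneg hε.le (sub_nonneg.2 hδ2)]
  -- the three thresholds, from Mathlib's `x ^ y → ∞`
  have hev : ∀ᶠ x : ℝ in atTop, ((n₀ : ℝ) ≤ x ^ (1 / 2 - ε) ∧ 6 ≤ x ^ η) ∧ 2 ≤ x ^ g :=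
    (((tendsto_rpow_atTop hε2).eventually_ge_atTop _).and
      ((tendsto_rpow_atTop hη).eventually_ge_atTop _)).and
      ((tendsto_rpow_atTop hg).eventually_ge_atTop _)
  obtain ⟨x₀, hx₀⟩ := Filter.eventually_atTop.1 hev
  refine ⟨max 1 ⌈x₀⌉₊, fun m hm L hL N hN p hp => ?_⟩
  have hm1 : 1 ≤ m := le_trans (le_max_left _ _) hm
  have hm1R : (1 : ℝ) ≤ m := by exact_mod_cast hm1
  have hm0R : (0 : ℝ) ≤ m := zero_le_one.trans hm1R
  have hx₀m : x₀ ≤ (m : ℝ) :=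
    (Nat.le_ceil x₀).trans (by exact_mod_cast le_trans (le_max_right _ _) hm)
  obtain ⟨⟨h₁, h₂⟩, h₃⟩ := hx₀ (m : ℝ) hx₀m
  -- the real size `M = m ^ L ≥ m` of the lifted host
  set M : ℝ := (m : ℝ) ^ L with hM
  have hmM : (m : ℝ) ≤ M := le_self_pow₀ hm1R (by omega)
  have hM1 : 1 ≤ M := hm1R.trans hmM
  have hM0 : 0 < M := one_pos.trans_le hM1
  have h₁' : (n₀ : ℝ) ≤ M ^ (1 / 2 - ε) := h₁.trans (Real.rpow_le_rpow hm0R hmM hε2.le)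
  have h₃' : (2 : ℝ) ≤ M ^ g := h₃.trans (Real.rpow_le_rpow hm0R hmM hg.le)
  have hNM : M ^ (1 / 2 - ε) ≤ N := by rwa [Real.rpow_natCast] at hN
  -- `p ≤ M ^ (1 + η)`
  have hpM : (p : ℝ) ≤ M ^ (1 + η) := by
    have h1 : (p : ℝ) ≤ 2 * (3 ^ L * (m : ℝ) ^ L) := by exact_mod_cast hp
    have h2 : (2 : ℝ) * 3 ^ L ≤ 6 ^ L := by
      have h22 : (2 : ℝ) ≤ 2 ^ L := by
        calc (2 : ℝ) = 2 ^ 1 := (pow_one _).symm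
          _ ≤ 2 ^ L := pow_le_pow_right₀ one_le_two hL
      calc (2 : ℝ) * 3 ^ L ≤ 2 ^ L * 3 ^ L := mul_le_mul_of_nonneg_right h22 (by positivity)
        _ = 6 ^ L := by rw [← mul_pow]; norm_num
    have h3 : (6 : ℝ) ^ L ≤ M ^ η := by
      calc (6 : ℝ) ^ L ≤ ((m : ℝ) ^ η) ^ L := pow_le_pow_left₀ (by norm_num) h₂ L
        _ = M ^ η := by
            rw [hM, ← Real.rpow_mul_natCast hm0R, mul_comm, Real.rpow_natCast_mul hm0R]
    calc (p : ℝ) ≤ 2 * 3 ^ L * M := by rw [mul_assoc]; exact h1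
      _ ≤ M ^ η * M := mul_le_mul_of_nonneg_right (h2.trans h3) hM0.le
      _ = M ^ (1 + η) := by rw [add_comm, Real.rpow_add_one hM0.ne']
  -- hence `p ^ (1/(2+δ)) ≤ M ^ ((1 + η)/(2+δ))`
  have hroot : (p : ℝ) ^ (2 + δ)⁻¹ ≤ M ^ ((1 + η) / (2 + δ)) := by
    calc (p : ℝ) ^ (2 + δ)⁻¹ ≤ (M ^ (1 + η)) ^ (2 + δ)⁻¹ :=
          Real.rpow_le_rpow (Nat.cast_nonneg _) hpM (inv_nonneg.2 h2δ.le)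
      _ = M ^ ((1 + η) / (2 + δ)) := by rw [← Real.rpow_mul hM0.le, ← div_eq_mul_inv]
  -- the number of blocks kept
  set n₁ : ℕ := ⌈(p : ℝ) ^ (2 + δ)⁻¹⌉₊ with hn₁
  have hnM : ((max n₀ n₁ : ℕ) : ℝ) ≤ M ^ (1 / 2 - ε) := by
    rw [Nat.cast_max]
    refine max_le h₁' ?_
    have h1 : (n₁ : ℝ) < (p : ℝ) ^ (2 + δ)⁻¹ + 1 :=
      Nat.ceil_lt_add_one (Real.rpow_nonneg (Nat.cast_nonneg _) _)
    have h2 : (1 : ℝ) ≤ M ^ ((1 + η) / (2 + δ)) := Real.one_le_rpow hM1 (by positivity)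
    calc (n₁ : ℝ) ≤ 2 * M ^ ((1 + η) / (2 + δ)) := by linarith
      _ ≤ M ^ g * M ^ ((1 + η) / (2 + δ)) := mul_le_mul_of_nonneg_right h₃' (by positivity)
      _ = M ^ (1 / 2 - ε) := by rw [← Real.rpow_add hM0, hg_def, sub_add_cancel]
  refine ⟨max n₀ n₁, le_max_left _ _, ?_, ?_, ?_⟩
  · -- `n ≤ N`
    exact_mod_cast hnM.trans hNM
  · -- `p ≤ n ^ (2+δ)`
    have hXn : (p : ℝ) ^ (2 + δ)⁻¹ ≤ ((max n₀ n₁ : ℕ) : ℝ) :=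
      (Nat.le_ceil _).trans (by exact_mod_cast le_max_right n₀ n₁)
    calc (p : ℝ) = ((p : ℝ) ^ (2 + δ)⁻¹) ^ (2 + δ) :=
          (Real.rpow_inv_rpow (Nat.cast_nonneg _) h2δ.ne').symm
      _ ≤ ((max n₀ n₁ : ℕ) : ℝ) ^ (2 + δ) :=
          Real.rpow_le_rpow (Real.rpow_nonneg (Nat.cast_nonneg _) _) hXn h2δ.le
  · -- `n ^ (2-δ) ≤ (m ^ (1-ε)) ^ L`
    calc ((max n₀ n₁ : ℕ) : ℝ) ^ (2 - δ) ≤ (M ^ (1 / 2 - ε)) ^ (2 - δ) :=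
          Real.rpow_le_rpow (Nat.cast_nonneg _) hnM (by linarith)
      _ = M ^ ((1 / 2 - ε) * (2 - δ)) := (Real.rpow_mul hM0.le _ _).symm
      _ ≤ M ^ (1 - ε) := Real.rpow_le_rpow_of_exponent_le hM1 hexp
      _ = ((m : ℝ) ^ (1 - ε)) ^ L := by
          rw [hM, ← Real.rpow_natCast_mul hm0R, mul_comm, Real.rpow_mul_natCast hm0R]

/-! ## The single-scale transfer -/

/-- **Capacity gadgets at one scale give a slice of the crux.**  Let `0 < δ` and `0 < ε < δ/(4+2δ)`
(`= 1/2 - 1/(2+δ)`).  If for arbitrarily large `m` there are direct pairs `(P c, Q c)_{c<r}` in `ZMod m`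
(`(x - x') + (y - y') = 0` with `x, x' ∈ P c`, `y, y' ∈ Q c` forces `x = x'`, `y = y'`) of co-volume
`m^{1-ε} ≤ |P c||Q c|`, and a set `W` of words `Fin L → Fin r` (`1 ≤ L`) of size `(m^L)^{1/2-ε} ≤ |W|` in
which every ordered pair of distinct words `i ≠ k` is strongly separated in some coordinate `t` (the cross
differences `Q (k t) - P (i t)` avoid every diagonal difference set `Q c - P c`), then `PrimeTwoFamiliesAt δ`:
arbitrarily large `n`, a prime `p ≤ n^{2+δ}` and `n` SDPP pairs in `ZMod p` with `|A i||B i| ≥ n^{2-δ}`.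
Proof: slices `δ > 2` hold trivially (`primeTwoFamiliesAt_two`); for `δ ≤ 2` take a level `m ≥ max m₀ 1`
with `m₀` from `capacityScale_bookkeeping`, enumerate `W` by `Fin |W|`, lift (`CapacityLift.codeLift`) to `|W|` SDPP
blocks in `Fin L → ZMod m` of co-volume `≥ (m^{1-ε})^L`, move them into a prime `p ≤ 2·3^L·m^L` with
sizes kept (`Theorems.exists_prime_sdpp_of_addEquiv`, `k = L` factors `ZMod m`), keep the first `n`
blocks. -/
theorem primeTwoFamiliesAt_of_capacityGadgetsAt {δ ε : ℝ} (hδ : 0 < δ) (hε : 0 < ε)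
    (hεδ : ε < δ / (4 + 2 * δ))
    (hC : ∀ m₀ : ℕ, ∃ m ≥ m₀, ∃ r L : ℕ, ∃ P Q : Fin r → Finset (ZMod m),
      ∃ W : Finset (Fin L → Fin r),
      (∀ c : Fin r, ∀ x ∈ P c, ∀ x' ∈ P c, ∀ y ∈ Q c, ∀ y' ∈ Q c,
          (x - x') + (y - y') = 0 → x = x' ∧ y = y') ∧
      (∀ i ∈ W, ∀ k ∈ W, i ≠ k → ∃ t : Fin L,
        ∀ p ∈ P (i t), ∀ q ∈ Q (k t), ∀ c : Fin r, ∀ p' ∈ P c, ∀ q' ∈ Q c, q - p ≠ q' - p') ∧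
      1 ≤ L ∧
      ((m : ℝ) ^ (L : ℝ)) ^ (1 / 2 - ε) ≤ (W.card : ℝ) ∧
      ∀ c : Fin r, (m : ℝ) ^ (1 - ε) ≤ (((P c).card * (Q c).card : ℕ) : ℝ)) :
    PrimeTwoFamiliesAt δ := by
  classical
  -- slices `δ > 2` hold trivially
  by_cases hδ2 : δ ≤ 2
  swap
  · exact primeTwoFamiliesAt_two.mono (le_of_lt (not_le.1 hδ2))
  intro n₀
  obtain ⟨m₀, hm₀⟩ := capacityScale_bookkeeping hδ hδ2 hε hεδ n₀
  obtain ⟨m, hm, r, L, P, Q, W, hD, hCode, hL, hWcard, hcov⟩ := hC (max m₀ 1)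
  have hm₀m : m₀ ≤ m := le_trans (le_max_left _ _) hm
  have hm1 : 1 ≤ m := le_trans (le_max_right _ _) hm
  -- the code and its enumeration (composition adapted from `CapacityLift.stub_capacityTransfer`)
  set N : ℕ := W.card with hN
  let e : W ≃ Fin N := W.equivFin
  -- the lifted family, indexed by `Fin N`
  let A : Fin N → Finset (Fin L → ZMod m) :=
    fun i => Fintype.piFinset (fun t => P ((e.symm i : Fin L → Fin r) t))
  let B : Fin N → Finset (Fin L → ZMod m) :=
    fun i => Fintype.piFinset (fun t => Q ((e.symm i : Fin L → Fin r) t))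
  obtain ⟨hW1, hX1⟩ := CapacityLift.codeLift P Q hD W hCode
  have hWA : ∀ i : Fin N, ∀ a ∈ A i, ∀ a' ∈ A i, ∀ b ∈ B i, ∀ b' ∈ B i,
      (a - a') + (b - b') = 0 → a = a' ∧ b = b' :=
    fun i => hW1 _ (e.symm i).2
  have hXA : ∀ i j k : Fin N, ∀ a ∈ A i, ∀ a' ∈ A j, ∀ b ∈ B j, ∀ b' ∈ B k,
      (a - a') + (b - b') = 0 → i = k := by
    intro i j k a ha a' ha' b hb b' hb' h0
    have hik := hX1 _ (e.symm i).2 _ (e.symm j).2 _ (e.symm k).2 a ha a' ha' b hb b' hb' h0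
    exact e.symm.injective (Subtype.ext hik)
  -- transfer into a prime cyclic host (route support CyclicReduction, transfer step)
  obtain ⟨p, hp, hpR, A', B', hcard, hW', hX'⟩ :=
    exists_prime_sdpp_of_addEquiv hWA hXA (m := fun _ : Fin L => m) (fun _ => hm1)
      (AddEquiv.refl (Fin L → ZMod m))
  rw [Fin.prod_const] at hpR
  -- the number of blocks kept
  obtain ⟨n, hn₀, hnN, hpn, hnP⟩ := hm₀ m hm₀m L hL N hWcard p hpR
  refine ⟨n, hn₀, p, hp, A' ∘ Fin.castLE hnN, B' ∘ Fin.castLE hnN, ?_, ?_, hpn, ?_⟩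
  · intro i
    exact hW' (Fin.castLE hnN i)
  · intro i j k a ha a' ha' b hb b' hb' h0
    exact Fin.castLE_injective hnN (hX' _ _ _ a ha a' ha' b hb b' hb' h0)
  · intro i
    have hci := hcard (Fin.castLE hnN i)
    simp only [Function.comp_apply]
    rw [hci.1, hci.2]
    simp only [A, B, Fintype.card_piFinset]
    rw [← Finset.prod_mul_distrib]
    refine hnP.trans ?_
    rw [← Fin.prod_const]
    push_cast
    refine Finset.prod_le_prod (fun t _ => by positivity) fun t _ => ?_
    exact_mod_cast hcov _

/-! ## The registered stub -/

/-- **Stub `primeTwoFamiliesAt_of_capacityGadgets` (line `Sketch`, capacity form): capacity gadgets at every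
scale give every slice `0 < δ ≤ 1` of the crux.**  If for every `ε > 0` there are arbitrarily large `m`,
direct pairs `(P c, Q c)_{c<r}` in `ZMod m` of co-volume `m^{1-ε} ≤ |P c||Q c|` and a zero-error code `W`
of words `Fin L → Fin r` (`1 ≤ L`, every ordered pair of distinct words strongly separated in some
coordinate) with `(m^L)^{1/2-ε} ≤ |W|`, then `PrimeTwoFamiliesAt δ`.  Corollary of the single-scale
transfer `primeTwoFamiliesAt_of_capacityGadgetsAt` at the scale `ε := δ/8 < δ/(4+2δ)` (as `δ ≤ 1`). -/
theorem primeTwoFamiliesAt_of_capacityGadgets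
    (hC : ∀ ε : ℝ, 0 < ε → ∀ m₀ : ℕ, ∃ m ≥ m₀, ∃ r L : ℕ, ∃ P Q : Fin r → Finset (ZMod m),
      ∃ W : Finset (Fin L → Fin r),
      (∀ c : Fin r, ∀ x ∈ P c, ∀ x' ∈ P c, ∀ y ∈ Q c, ∀ y' ∈ Q c,
          (x - x') + (y - y') = 0 → x = x' ∧ y = y') ∧
      (∀ i ∈ W, ∀ k ∈ W, i ≠ k → ∃ t : Fin L,
        ∀ p ∈ P (i t), ∀ q ∈ Q (k t), ∀ c : Fin r, ∀ p' ∈ P c, ∀ q' ∈ Q c, q - p ≠ q' - p') ∧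
      1 ≤ L ∧
      ((m : ℝ) ^ (L : ℝ)) ^ (1 / 2 - ε) ≤ (W.card : ℝ) ∧
      ∀ c : Fin r, (m : ℝ) ^ (1 - ε) ≤ (((P c).card * (Q c).card : ℕ) : ℝ))
    {δ : ℝ} (hδ : 0 < δ) (hδ1 : δ ≤ 1) : PrimeTwoFamiliesAt δ := by
  have h8 : δ / 8 < δ / (4 + 2 * δ) := by
    rw [div_lt_div_iff₀ (by norm_num) (by linarith)]
    nlinarith [mul_pos hδ (show (0 : ℝ) < 4 - 2 * δ by linarith)]
  exact primeTwoFamiliesAt_of_capacityGadgetsAt hδ (by positivity) h8 (hC (δ / 8) (by positivity))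

end Summit.MatrixMultiplication.MatrixMultiplication.Theorems.PrimeTwoFamilies.CapacityScale
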